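import Summits.AtomisticToContinuum.Crystallization.Theorems.FrustratedLawDichotomyCellF1Host

/-!
# FrustratedLawDichotomy · crux `AperiodicFrustratedLawGap` (stmt-AtomisticToContinuum-27623) — class-A K-file skeleton, layer 2e:
metric facts of the F1 INTERIOR and the constant-dial mirror condition (decomp-a2c hand-2 g47, structural share)

List-free consequences of layers 1–2c for the interior set `MIF1` (403 labels, `(1 + 3ε)|T z|² ≤ R_A² = 16`): under every `F` of the strain cell
an interior label is placed within distance `4` of the root (`norm_MI_le`, (260) `norm_le_of_nearId`), every label within `Rc − τ` (`norm_M_le`);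
the interior lies in the integer ball `sqT < 40` about the root (`sqT_le_of_MI`, `MI_subset_ballL` — the `hMIA` shape of the (251) master with
`ℓ_A = 40`); and ★ `hnbh_F1_const` — the (251) `hnbh` hypothesis for `nbh := mirrorNbh MF1 mirT` with ANY CONSTANT dial `Lh ≤ RwF1 − 4 ≈ 8.96`
(so the host column's per-label radius is a single number for the F1 cell).
-/

namespace Summit.AtomisticToContinuum.Crystallization.Theorems.FrustratedLawDichotomyCellF1Interior

open scoped BigOperators
open Summit.AtomisticToContinuum.Crystallization.Theorems.FrustratedLawDichotomyCellMetric (posL)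
open Summit.AtomisticToContinuum.Crystallization.Theorems.FrustratedLawDichotomyCellData (norm_le_of_nearId)
open Summit.AtomisticToContinuum.Crystallization.Theorems.FrustratedLawDichotomyCellClasses (ballL)
open Summit.AtomisticToContinuum.Crystallization.Theorems.FrustratedLawDichotomyCellTriples (zT sumT sqT subT mem_ballL_zT)
open Summit.AtomisticToContinuum.Crystallization.Theorems.FrustratedLawDichotomyCellHostMirror (mirrorNbh mirT)
open Summit.AtomisticToContinuum.Crystallization.Theorems.FrustratedLawDichotomyCellF1Frame
  (T qk BI admI_iff qk_eq interior_of_admI window_of_admL admL_iff)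
open Summit.AtomisticToContinuum.Crystallization.Theorems.FrustratedLawDichotomyCellF1Labels (MF1 MIF1 mem_M mem_MI MI_subset_M)
open Summit.AtomisticToContinuum.Crystallization.Theorems.FrustratedLawDichotomyCellF1Host (RwF1 hnbh_F1)

/-- ★ an interior label is placed within distance `R_A = 4` of the root, under every `F` of the strain cell. -/
theorem norm_MI_le {F : Matrix (Fin 3) (Fin 3) ℝ} (hG : ∀ i j, |(F.transpose * F) i j - (if i = j then 1 else 0)| ≤ 1 / 1024) :
    ∀ m ∈ MIF1, ‖posL F (T.mulVec fun j => (zT m j : ℝ))‖ ≤ 4 :=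
  fun m hm => norm_le_of_nearId hG (by norm_num) (interior_of_admI ((admI_iff m).mp (mem_MI.mp hm)).2)

/-- every label is placed within distance `Rc − τ = 13 − 1/1024` of the root, under every `F` of the strain cell. -/
theorem norm_M_le {F : Matrix (Fin 3) (Fin 3) ℝ} (hG : ∀ i j, |(F.transpose * F) i j - (if i = j then 1 else 0)| ≤ 1 / 1024) :
    ∀ m ∈ MF1, ‖posL F (T.mulVec fun j => (zT m j : ℝ))‖ ≤ 13 - 1 / 1024 :=
  fun m hm => norm_le_of_nearId hG (by norm_num) (window_of_admL ((admL_iff m).mp (mem_M.mp hm)).2)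

/-- the window hypothesis `‖a_F m‖ + τ ≤ Rc` of the doors, for every label. -/
theorem norm_M_add_tau_le {F : Matrix (Fin 3) (Fin 3) ℝ} (hG : ∀ i j, |(F.transpose * F) i j - (if i = j then 1 else 0)| ≤ 1 / 1024) :
    ∀ m ∈ MF1, ‖posL F (T.mulVec fun j => (zT m j : ℝ))‖ + 1 / 1024 ≤ 13 :=
  fun m hm => by linarith [norm_M_le hG m hm]

/-- an interior label has integer squared length `≤ 39` (`qk ≤ BI` and `qk ≥ q₁·sqT`). -/
theorem sqT_le_of_MI : ∀ m ∈ MIF1, sqT m ≤ 39 := by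
  intro m hm
  have hq := ((admI_iff m).mp (mem_MI.mp hm)).2
  rw [qk_eq] at hq; unfold BI at hq
  unfold sqT
  nlinarith [mul_self_nonneg m.1, mul_self_nonneg m.2.1, mul_self_nonneg m.2.2, sq_nonneg m.1, sq_nonneg m.2.1, sq_nonneg m.2.2]

/-- ★ the interior lies in the integer ball of radius `40` about the root (the `hMIA` shape of the (251) master, `ℓ_A := 40`). -/
theorem MI_subset_ballL : MIF1 ⊆ ballL MF1 zT 40 (0 : ℤ × ℤ × ℤ) := by
  intro m hm
  rw [mem_ballL_zT]
  refine ⟨MI_subset_M hm, ?_⟩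
  have h := sqT_le_of_MI m hm
  have e : sqT (subT m 0) = sqT m := by simp [sqT, subT]
  omega

/-- ★ the (251) `hnbh` hypothesis of the F1 cell for `nbh := mirrorNbh MF1 mirT` with a CONSTANT dial: any `L ≤ RwF1 − 4` (e.g. `L = 8`) works for
every interior label, under every `F` of the strain cell. -/
theorem hnbh_F1_const {F : Matrix (Fin 3) (Fin 3) ℝ} (hG : ∀ i j, |(F.transpose * F) i j - (if i = j then 1 else 0)| ≤ 1 / 1024)
    {L : ℝ} (hL : L ≤ RwF1 - 4) :
    ∀ m ∈ MIF1, ∀ m' ∈ MF1, m' ≠ m → m' ∉ mirrorNbh MF1 mirT m →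
      L ≤ dist (posL F (T.mulVec fun j => (zT m' j : ℝ))) (posL F (T.mulVec fun j => (zT m j : ℝ))) :=
  hnbh_F1 hG (Lh := fun _ => L) fun m hm => by linarith [norm_MI_le hG m hm]

/-- the numeric instance `L = 8`: `8 ≤ RwF1 − 4`. -/
theorem eight_le_RwF1_sub : (8 : ℝ) ≤ RwF1 - 4 := by unfold RwF1; norm_num

end Summit.AtomisticToContinuum.Crystallization.Theorems.FrustratedLawDichotomyCellF1Interior
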